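import Literature.NumberTheory.Automorphic.RestrictedTensorProductLift
import Literature.NumberTheory.Automorphic.RestrictedTensorCoinvariantBound
import HarnessLib

/-!
# Quotients of a restricted tensor product by slotwise-generated relations

Topic `NumberTheory/Automorphic`.  Kernel consequences of the tree's restricted-tensor-product API
(`RestrictedTensorProduct.lean`: the characterising predicate `IsRestrictedTensorProduct k j S₀` of a model `(W, j)`
of `⊗'_i (V i, x₀ i)`; `…ExistenceProofs.lean`: the constructed model `RestrictedTensorProduct k x₀` with
`RestrictedTensorProduct.tprod` and the injectivity of its finite levels; `…Lift.lean`: the explicit universal map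
`IsRestrictedTensorProduct.lift` and `RestrictedFamily.piMap`; `RestrictedTensorCoinvariantBound.lean`: the slot maps
`IsRestrictedMultilinear.slot`).  Pure linear algebra: for a model `(W, j)` of `⊗'_i (V i, x₀ i)`, submodules
`N i ≤ V i` and a submodule `M ≤ W` GENERATED SLOT BY SLOT by the `N i`, the quotient `W ⧸ M` with the classes
`[x₀ i]` as base vectors is a restricted tensor product of the quotients `V i ⧸ N i` — the restricted form of
«`(⊗_i V_i) ⧸ Σ_i (⋯ ⊗ N_i ⊗ ⋯) = ⊗_i (V_i ⧸ N_i)`» (right-exactness of `⊗`; Bernstein–Zelevinsky 1977, §4.7), i.e.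
the module-theoretic content of «coinvariants of `⊗'_v π_v` are `⊗'_v` of the local coinvariants» (consumer:
`RestrictedTensorProductCoinvariants.lean`).

## What is proved

* `RestrictedFamily.sub_prod_smul_mem_of_slotwise` — the TELESCOPING identity along finitely many slots: if `z` and
  `x` agree off a finset `U` and slot by slot `j (y; i ↦ z i) − c i • j (y; i ↦ x i) ∈ P` for every `y`, then
  `j z − (∏_{i ∈ U} c i) • j x ∈ P`.
* `RestrictedFamily.piMap_mkQ_surjective` — every restricted family of local classes `(V i ⧸ N i, [x₀ i])` lifts to a
  restricted family of vectors.
* `IsRestrictedMultilinear.exists_quotientMap` — if the slotwise images `j (x; i ↦ n)`, `n ∈ N i`, lie in `M`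
  (hypothesis `hNM`), the class of `j x` in `W ⧸ M` depends only on the local classes `[x i]`
  (`sub_mem_of_piMap_mkQ_eq`): there is a map `J : RestrictedFamily (V i ⧸ N i) ([x₀ i]) → W ⧸ M` with
  `J ([x i])_i = [j x]`; such a `J` is unique (the families of classes are lifts) and restricted-multilinear
  (`IsRestrictedMultilinear.quotientMap`).  All later statements are about ANY `J` with this property.
* `IsRestrictedTensorProduct.exists_quotient_lift` — if `M` is spanned by slotwise images (hypothesis `hMN`),
  `(W ⧸ M, J)` has the universal property of `⊗'_i (V i ⧸ N i, [x₀ i])` for restricted-multilinear maps.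
* `IsRestrictedTensorProduct.quotient` — MAIN (over a field): under `hMN`, `(W ⧸ M, J)` IS a restricted tensor
  product of the `(V i ⧸ N i, [x₀ i])` in the sense of the tree's predicate, with exceptional set any finite `S₁` off
  which the base vector SURVIVES in the local quotient (`x₀ i ∉ N i` — the one non-formal input; it is what makes
  the finite levels injective).  Proof: the universal property maps `W ⧸ M` to the tree's constructed model, whose
  finite levels are injective (`RestrictedTensorProduct.injective_liftFinset`); exhaustion is inherited from `W`.

Theorems only (the comparison map `J` is delivered as an existential with its defining property); no definition, no
named fact, no instance, no `sorry`.

## References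

* D. Flath, *Decomposition of representations into tensor products*, Proc. Sympos. Pure Math. 33 (1979), part 1,
  179–183, §2 (restricted tensor products as direct limits of the finite levels; functoriality). [Flath1979]
* I. N. Bernstein, A. V. Zelevinsky, *Induced representations of reductive `p`-adic groups I*, Ann. Sci. ÉNS 10
  (1977), §4.7 (coinvariants of a tensor product, factor by factor). [BernsteinZelevinskyASENS1977]
* D. Bump, *Automorphic Forms and Representations*, Cambridge Stud. Adv. Math. 55 (1997), §3.3–§3.4.
-/

noncomputable section

open scoped RestrictedProduct TensorProduct
open Filter PiTensorProduct Function

namespace Literature.NumberTheory.Automorphic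

universe u uk v w w'

/-! ### §1 Quotients of a restricted tensor product by slotwise relations (commutative ring) -/

section Module

variable {ι : Type u} {k : Type uk} [CommRing k] {V : ι → Type v} [∀ i, AddCommGroup (V i)]
  [∀ i, Module k (V i)] {x₀ : ∀ i, V i} {W : Type w} [AddCommGroup W] [Module k W] [DecidableEq ι]
  {j : RestrictedFamily V x₀ → W} {S₀ : Finset ι} {N : ∀ i, Submodule k (V i)} {M : Submodule k W}
  {hq : ∀ᶠ i in cofinite, (N i).mkQ (x₀ i) = (N i).mkQ (x₀ i)}

/-- Slot linearity, subtractive form: `j (y; i ↦ v − w) = j (y; i ↦ v) − j (y; i ↦ w)` (restricted-multilinear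
maps are linear in each slot; Flath 1979, §2). [cite: Flath1979, §2] -/
theorem IsRestrictedMultilinear.apply_update_sub (hj : IsRestrictedMultilinear k j)
    (y : RestrictedFamily V x₀) (i : ι) (v w : V i) :
    j (y.update i (v - w)) = j (y.update i v) - j (y.update i w) := by
  show hj.slot y i (v - w) = hj.slot y i v - hj.slot y i w
  rw [map_sub]

omit [∀ i, AddCommGroup (V i)] [∀ i, Module k (V i)] in
/-- **Telescoping along finitely many slots.**  Let `P ≤ W` be a submodule, `c : ι → k`, and `x`, `z` two
restricted families agreeing off a finset `U` such that, for every `i ∈ U` and EVERY restricted family `y`,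
`j (y; i ↦ z i) − c i • j (y; i ↦ x i) ∈ P`.  Then `j z − (∏_{i ∈ U} c i) • j x ∈ P` (change the slots of `x` into
those of `z` one at a time).  This is the computation behind «the relations of `⊗_i V i` under a product group are
generated slot by slot» (Bernstein–Zelevinsky 1977, §4.7). [cite: Flath1979, §2] -/
theorem RestrictedFamily.sub_prod_smul_mem_of_slotwise (j : RestrictedFamily V x₀ → W) (P : Submodule k W)
    (c : ι → k) (x : RestrictedFamily V x₀) (U : Finset ι) (z : RestrictedFamily V x₀)
    (hoff : ∀ i ∉ U, z i = x i)
    (hon : ∀ i ∈ U, ∀ y : RestrictedFamily V x₀, j (y.update i (z i)) - c i • j (y.update i (x i)) ∈ P) :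
    j z - (∏ i ∈ U, c i) • j x ∈ P := by
  induction U using Finset.induction_on generalizing z with
  | empty =>
    have hz : z = x := by
      ext i
      exact hoff i (Finset.notMem_empty i)
    rw [hz, Finset.prod_empty, _root_.one_smul, sub_self]
    exact P.zero_mem
  | insert a U haU ih =>
    -- `z' := z` with the slot `a` reset to `x a`
    have hz'off : ∀ i ∉ U, z.update a (x a) i = x i := fun i hi => by
      by_cases hia : i = a
      · subst hia
        simp
      · rw [RestrictedFamily.update_apply, Function.update_of_ne hia]
        exact hoff i (by simp [Finset.mem_insert, hia, hi])
    have hz'on : ∀ i ∈ U, ∀ y : RestrictedFamily V x₀,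
        j (y.update i (z.update a (x a) i)) - c i • j (y.update i (x i)) ∈ P := fun i hi y => by
      have hia : i ≠ a := fun h => haU (h ▸ hi)
      rw [RestrictedFamily.update_apply, Function.update_of_ne hia]
      exact hon i (Finset.mem_insert_of_mem hi) y
    have h1 := hon a (Finset.mem_insert_self a U) (z.update a (x a))
    have e1 : (z.update a (x a)).update a (z a) = z := by
      ext l
      by_cases hl : l = a
      · subst hl
        simp
      · simp [Function.update_of_ne hl]
    have e2 : (z.update a (x a)).update a (x a) = z.update a (x a) := by
      ext l
      by_cases hl : l = a
      · subst hl
        simp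
      · simp [Function.update_of_ne hl]
    rw [e1, e2] at h1
    have h2 := ih (z.update a (x a)) hz'off hz'on
    have key : j z - (∏ i ∈ insert a U, c i) • j x =
        (j z - c a • j (z.update a (x a))) + c a • (j (z.update a (x a)) - (∏ i ∈ U, c i) • j x) := by
      rw [Finset.prod_insert haU, SemigroupAction.mul_smul, smul_sub]
      abel
    rw [key]
    exact P.add_mem h1 (P.smul_mem _ h2)

/-- `piMap` of the quotient maps commutes with updating a coordinate. [folklore] -/
private theorem RestrictedFamily.piMap_mkQ_update (x : RestrictedFamily V x₀) (i : ι) (v : V i) :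
    RestrictedFamily.piMap (x₀' := fun i => (N i).mkQ (x₀ i)) (fun i => (N i).mkQ) hq (x.update i v) =
      (RestrictedFamily.piMap (x₀' := fun i => (N i).mkQ (x₀ i)) (fun i => (N i).mkQ) hq x).update i
        ((N i).mkQ v) :=
  RestrictedFamily.piMap_update _ hq x i v

omit [DecidableEq ι] in
/-- **Every restricted family of local classes lifts**: the coordinatewise quotient map
`RestrictedFamily (V i, x₀ i) → RestrictedFamily (V i ⧸ N i, [x₀ i])` is onto (lift the finitely many
non-base classes arbitrarily, keep the base vector elsewhere; Flath 1979, §2: restricted families with respect to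
base vectors). [cite: Flath1979, §2] -/
theorem RestrictedFamily.piMap_mkQ_surjective (N : ∀ i, Submodule k (V i))
    (hq : ∀ᶠ i in cofinite, (N i).mkQ (x₀ i) = (N i).mkQ (x₀ i)) :
    Surjective (RestrictedFamily.piMap (x₀' := fun i => (N i).mkQ (x₀ i)) (fun i => (N i).mkQ) hq) := by
  classical
  intro y
  choose v hv using fun i => (N i).mkQ_surjective (y i)
  refine ⟨RestrictedProduct.mk (fun i => if y i = (N i).mkQ (x₀ i) then x₀ i else v i)
    (y.eventually_eq.mono fun i hi => ?_), ?_⟩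
  · have hi' : y i = (N i).mkQ (x₀ i) := hi
    show (if y i = (N i).mkQ (x₀ i) then x₀ i else v i) ∈ ({x₀ i} : Set (V i))
    rw [if_pos hi']
    exact Set.mem_singleton _
  · ext i
    rw [RestrictedFamily.piMap_apply]
    show (N i).mkQ (if y i = (N i).mkQ (x₀ i) then x₀ i else v i) = y i
    split_ifs with h
    · exact h.symm
    · exact hv i

/-- **The class of `j x` modulo `M` depends only on the local classes** when the slotwise images `j (x; i ↦ n)`,
`n ∈ N i`, lie in `M`: two restricted families with the same classes `[x i] = [x' i]` differ in finitely many slots,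
each difference lying in `N i`; telescope. [cite: Flath1979, §2] -/
theorem IsRestrictedMultilinear.sub_mem_of_piMap_mkQ_eq (hj : IsRestrictedMultilinear k j)
    (hNM : ∀ (x : RestrictedFamily V x₀) (i : ι), ∀ n ∈ N i, j (x.update i n) ∈ M)
    {x x' : RestrictedFamily V x₀}
    (hxx' : RestrictedFamily.piMap (x₀' := fun i => (N i).mkQ (x₀ i)) (fun i => (N i).mkQ) hq x' =
      RestrictedFamily.piMap (x₀' := fun i => (N i).mkQ (x₀ i)) (fun i => (N i).mkQ) hq x) :
    j x' - j x ∈ M := by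
  classical
  obtain ⟨T, -, hT⟩ :=
    RestrictedFamily.exists_finset_forall_apply_eq (∅ : Finset ι) ({x, x'} : Finset (RestrictedFamily V x₀))
  have hloc : ∀ i, x' i - x i ∈ N i := fun i => by
    have h := DFunLike.congr_fun hxx' i
    rw [RestrictedFamily.piMap_apply, RestrictedFamily.piMap_apply, Submodule.mkQ_apply, Submodule.mkQ_apply,
      Submodule.Quotient.eq] at h
    exact h
  have h := RestrictedFamily.sub_prod_smul_mem_of_slotwise j M (fun _ => (1 : k)) x T x'
    (fun i hi => by rw [hT x' (by simp) i hi, hT x (by simp) i hi])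
    (fun i _ y => by
      rw [one_smul, ← hj.apply_update_sub]
      exact hNM y i _ (hloc i))
  simpa using h

/-- **Existence of the comparison map.**  If the slotwise images of the `N i` lie in `M`, there is a map
`J : RestrictedFamily (V i ⧸ N i, [x₀ i]) → W ⧸ M` with `J ([x i])_i = [j x]` for every restricted family `x` of
vectors (well defined by `sub_mem_of_piMap_mkQ_eq`; unique because the families of classes are lifts,
`piMap_mkQ_surjective`).  All later statements are about ANY `J` with this property (hypothesis `hJ`). [cite: Flath1979, §2] -/
theorem IsRestrictedMultilinear.exists_quotientMap (hj : IsRestrictedMultilinear k j)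
    (hNM : ∀ (x : RestrictedFamily V x₀) (i : ι), ∀ n ∈ N i, j (x.update i n) ∈ M)
    (hq : ∀ᶠ i in cofinite, (N i).mkQ (x₀ i) = (N i).mkQ (x₀ i)) :
    ∃ J : RestrictedFamily (fun i => V i ⧸ N i) (fun i => (N i).mkQ (x₀ i)) → W ⧸ M,
      ∀ x : RestrictedFamily V x₀,
        J (RestrictedFamily.piMap (x₀' := fun i => (N i).mkQ (x₀ i)) (fun i => (N i).mkQ) hq x) = M.mkQ (j x) := by
  obtain ⟨s, hs⟩ := (RestrictedFamily.piMap_mkQ_surjective N hq).hasRightInverse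
  refine ⟨fun y => M.mkQ (j (s y)), fun x => ?_⟩
  show M.mkQ (j (s _)) = M.mkQ (j x)
  rw [Submodule.mkQ_apply, Submodule.mkQ_apply, Submodule.Quotient.eq]
  exact hj.sub_mem_of_piMap_mkQ_eq hNM (hs _)

/-- **Such a comparison map is restricted-multilinear** (slot linearity of `j` read through the surjections
`V i → V i ⧸ N i` and the lifting of families of classes). [cite: Flath1979, §2] -/
theorem IsRestrictedMultilinear.quotientMap (hj : IsRestrictedMultilinear k j)
    (J : RestrictedFamily (fun i => V i ⧸ N i) (fun i => (N i).mkQ (x₀ i)) → W ⧸ M)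
    (hJ : ∀ x : RestrictedFamily V x₀,
      J (RestrictedFamily.piMap (x₀' := fun i => (N i).mkQ (x₀ i)) (fun i => (N i).mkQ) hq x) = M.mkQ (j x)) :
    IsRestrictedMultilinear k J where
  map_update_add y i q₁ q₂ := by
    obtain ⟨x, rfl⟩ := RestrictedFamily.piMap_mkQ_surjective N hq y
    obtain ⟨v₁, rfl⟩ := (N i).mkQ_surjective q₁
    obtain ⟨v₂, rfl⟩ := (N i).mkQ_surjective q₂
    rw [← map_add, ← RestrictedFamily.piMap_mkQ_update, ← RestrictedFamily.piMap_mkQ_update,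
      ← RestrictedFamily.piMap_mkQ_update, hJ, hJ, hJ, hj.map_update_add, map_add]
  map_update_smul y i c q := by
    obtain ⟨x, rfl⟩ := RestrictedFamily.piMap_mkQ_surjective N hq y
    obtain ⟨v, rfl⟩ := (N i).mkQ_surjective q
    rw [← map_smul, ← RestrictedFamily.piMap_mkQ_update, ← RestrictedFamily.piMap_mkQ_update, hJ, hJ,
      hj.map_update_smul, map_smul]

/-- **Universal property of `(W ⧸ M, J)`.**  If `M` is spanned by slotwise images `j (x; i ↦ n)`, `n ∈ N i`
(hypothesis `hMN`), every restricted-multilinear map `ψ` out of the families of local classes factors through `J`: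
`ψ = L ∘ J` for a linear `L : W ⧸ M → U`.  (`ψ ∘ [·]` is restricted-multilinear on families of vectors, hence
factors through `W` by the universal map of `(W, j)`; that map kills the generators of `M`, a restricted-multilinear
map vanishing when one slot is `0`.) [cite: Flath1979, §2] -/
theorem IsRestrictedTensorProduct.exists_quotient_lift (h : IsRestrictedTensorProduct k j S₀)
    (hMN : M ≤ Submodule.span k {w | ∃ (x : RestrictedFamily V x₀) (i : ι) (n : V i),
      n ∈ N i ∧ j (x.update i n) = w})
    (J : RestrictedFamily (fun i => V i ⧸ N i) (fun i => (N i).mkQ (x₀ i)) → W ⧸ M)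
    (hJ : ∀ x : RestrictedFamily V x₀,
      J (RestrictedFamily.piMap (x₀' := fun i => (N i).mkQ (x₀ i)) (fun i => (N i).mkQ) hq x) = M.mkQ (j x))
    {U : Type w'} [AddCommGroup U] [Module k U]
    {ψ : RestrictedFamily (fun i => V i ⧸ N i) (fun i => (N i).mkQ (x₀ i)) → U}
    (hψ : IsRestrictedMultilinear k ψ) :
    ∃ L : (W ⧸ M) →ₗ[k] U, ∀ y, L (J y) = ψ y := by
  have hψ' := hψ.comp_piMap (x₀ := x₀) (fun i => (N i).mkQ) hq
  have hker : M ≤ LinearMap.ker (h.lift hψ') := by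
    refine hMN.trans (Submodule.span_le.2 ?_)
    rintro _ ⟨x, i, n, hn, rfl⟩
    rw [SetLike.mem_coe, LinearMap.mem_ker, h.lift_apply]
    have h0 : (N i).mkQ n = 0 := (Submodule.Quotient.mk_eq_zero (N i)).2 hn
    have hz := hψ.map_update_smul
      (RestrictedFamily.piMap (x₀' := fun i => (N i).mkQ (x₀ i)) (fun i => (N i).mkQ) hq x) i (0 : k) 0
    rw [zero_smul, zero_smul] at hz
    show ψ (RestrictedFamily.piMap (x₀' := fun i => (N i).mkQ (x₀ i)) (fun i => (N i).mkQ) hq (x.update i n)) = 0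
    rw [RestrictedFamily.piMap_mkQ_update, h0, hz]
  refine ⟨M.liftQ (h.lift hψ') hker, fun y => ?_⟩
  obtain ⟨x, rfl⟩ := RestrictedFamily.piMap_mkQ_surjective N hq y
  rw [hJ, Submodule.mkQ_apply, Submodule.liftQ_apply, h.lift_apply]

/-- The extension by base classes of a finite family of classes `[m i]`, `i ∈ S`, is the family of classes of the
extension of `m` by base vectors. [folklore] -/
private theorem RestrictedFamily.extend_mkQ_eq_piMap_extend (S : Finset ι) (m : ∀ i : S, V i) :
    RestrictedFamily.extend (x₀ := fun i => (N i).mkQ (x₀ i)) S (fun i : S => (N i).mkQ (m i)) =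
      RestrictedFamily.piMap (x₀' := fun i => (N i).mkQ (x₀ i)) (fun i => (N i).mkQ) hq
        (RestrictedFamily.extend S m) := by
  ext l
  rw [RestrictedFamily.piMap_apply]
  by_cases hl : l ∈ S
  · rw [RestrictedFamily.extend_apply_of_mem _ _ hl, RestrictedFamily.extend_apply_of_mem _ _ hl]
  · rw [RestrictedFamily.extend_apply_of_notMem _ _ hl, RestrictedFamily.extend_apply_of_notMem _ _ hl]

end Module

/-! ### §1b The main theorem (field) -/

section Field

variable {ι : Type u} {k : Type uk} [Field k] {V : ι → Type v} [∀ i, AddCommGroup (V i)]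
  [∀ i, Module k (V i)] {x₀ : ∀ i, V i} {W : Type w} [AddCommGroup W] [Module k W] [DecidableEq ι]
  {j : RestrictedFamily V x₀ → W} {S₀ : Finset ι} {N : ∀ i, Submodule k (V i)} {M : Submodule k W}
  {hq : ∀ᶠ i in cofinite, (N i).mkQ (x₀ i) = (N i).mkQ (x₀ i)}

/-- **A quotient of a restricted tensor product by slotwise-generated relations is the restricted tensor product of
the quotients.**  Over a field: let `(W, j)` be a model of `⊗'_i (V i, x₀ i)`, `N i ≤ V i`, `M ≤ W` a submodule
spanned by slotwise images `j (x; i ↦ n)`, `n ∈ N i` (`hMN`), and `J ([x i])_i = [j x]` (`hJ`).  Then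
`(W ⧸ M, J)` is a restricted tensor product of the `(V i ⧸ N i, [x₀ i])`, with exceptional set any finite `S₁` off
which the base vector survives in the local quotient (`x₀ i ∉ N i`).  Injectivity of the finite levels: map
`W ⧸ M` to the tree's model `⊗'_i (V i ⧸ N i, [x₀ i])` by the universal property (`exists_quotient_lift`); there the
finite levels over `S ⊇ S₁` are injective (`RestrictedTensorProduct.injective_liftFinset`, base classes non-zero off
`S₁`).  Exhaustion is inherited from `W`.  (Flath 1979, §2: `⊗'` as the direct limit of the finite levels; the
finite-level statement `(⊗_{i∈S} V i) ⧸ Σ_i (… ⊗ N i ⊗ …) = ⊗_{i∈S} (V i ⧸ N i)` is right-exactness of `⊗`.)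
[cite: Flath1979, §2] -/
theorem IsRestrictedTensorProduct.quotient (h : IsRestrictedTensorProduct k j S₀)
    (hMN : M ≤ Submodule.span k {w | ∃ (x : RestrictedFamily V x₀) (i : ι) (n : V i),
      n ∈ N i ∧ j (x.update i n) = w})
    {S₁ : Finset ι} (hx₀N : ∀ i ∉ S₁, x₀ i ∉ N i)
    (J : RestrictedFamily (fun i => V i ⧸ N i) (fun i => (N i).mkQ (x₀ i)) → W ⧸ M)
    (hJ : ∀ x : RestrictedFamily V x₀,
      J (RestrictedFamily.piMap (x₀' := fun i => (N i).mkQ (x₀ i)) (fun i => (N i).mkQ) hq x) = M.mkQ (j x)) :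
    IsRestrictedTensorProduct k J S₁ := by
  have hJm : IsRestrictedMultilinear k J := h.isRestrictedMultilinear.quotientMap J hJ
  refine ⟨hJm, fun S hS => ?_, ?_⟩
  · -- injectivity of the finite level `S ⊇ S₁`: compare with the constructed model `⊗'_i (V i ⧸ N i, [x₀ i])`
    obtain ⟨e, he⟩ := h.exists_quotient_lift hMN J hJ
      (RestrictedTensorProduct.isRestrictedMultilinear_tprod (k := k) (x₀ := fun i => (N i).mkQ (x₀ i)))
    obtain ⟨ℓ, hℓ⟩ := exists_forall_dual_apply_eq_one (k := k) (x₀ := fun i => (N i).mkQ (x₀ i)) S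
      (fun i hi => by
        rw [Ne, Submodule.mkQ_apply, Submodule.Quotient.mk_eq_zero]
        exact hx₀N i fun h' => hi (hS h'))
    have hcomp : ⇑e ∘ ⇑(hJm.liftFinset S) =
        ⇑((RestrictedTensorProduct.isRestrictedMultilinear_tprod (k := k)
          (x₀ := fun i => (N i).mkQ (x₀ i))).liftFinset S) := by
      refine funext fun t => ?_
      rw [Function.comp_apply]
      induction t using PiTensorProduct.induction_on with
      | smul_tprod r m =>
        rw [map_smul, map_smul, map_smul, IsRestrictedMultilinear.liftFinset_tprod,
          IsRestrictedMultilinear.liftFinset_tprod, he]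
      | add a b ha hb => rw [map_add, map_add, map_add, ha, hb]
    refine Function.Injective.of_comp (f := ⇑e) ?_
    rw [hcomp]
    exact RestrictedTensorProduct.injective_liftFinset hℓ
  · -- exhaustion: `[w]` for `w` of finite level `S` is the image of the level-`S` tensor of classes
    rw [eq_top_iff]
    rintro q -
    obtain ⟨w, rfl⟩ := M.mkQ_surjective q
    obtain ⟨S, -, hw⟩ := h.exists_mem_range_liftFinset ∅ w
    obtain ⟨t, rfl⟩ := LinearMap.mem_range.1 hw
    clear hw
    refine Submodule.mem_iSup_of_mem S ⟨PiTensorProduct.map (fun i : S => (N (i : ι)).mkQ) t, ?_⟩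
    induction t using PiTensorProduct.induction_on with
    | smul_tprod r m =>
      simp only [map_smul, PiTensorProduct.map_tprod, IsRestrictedMultilinear.liftFinset_tprod]
      rw [RestrictedFamily.extend_mkQ_eq_piMap_extend (hq := hq) S m, hJ]
    | add a b ha hb => simp only [map_add, ha, hb]

end Field

end Literature.NumberTheory.Automorphic

end
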